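import Mathlib
import HarnessLib

/-!
# SHEET-ℝ, towards «linearly stable modulo gauge» (renewal route, brick (R-b)): decay bookkeeping for the scalar renewal equation
# once its resolvent splits as `c·eᵗ + r₁` with `r₁ ∈ L¹(e^{βt}dt)`

HONEST FRAMING (cell ns-blowup GROUP B / zone Z3, case Z3-SR-SPEC, P-list (P9)/(P10); design memo `HOME/profile/cert/cert5/P9-P10-RENEWAL-DESIGN.md` v2
(cert-5 g6) §1/(R-b); profile-lead RULING (hr)(3): finding adopted, NOTHING BOUGHT — this is a 0-kit brick of the banked turnkey; 1-D MODEL frame; not Euler/NS;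
«violates: none — MODEL»). Pure real/complex calculus on the half-line; no operator, no profile, no number of record.
THE SITUATION (memo §1): the gauge-mode amplitude `m(t) = θ⟪h, δ(t)⟫` of a mild solution of the linearised flow solves the scalar renewal equation
`m = m₀ + k ⋆ m` (`(a ⋆ b)(t) = ∫₀ᵗ a(t − s) b(s) ds`), whose resolvent `r` (`r = k + k ⋆ r`) gives `m = m₀ + r ⋆ m₀`; the Z3-SR-SPEC spectral sentence says the
symbol `1 − k̂ = E` has exactly one simple zero at `σ = 1` in `{Re σ ≥ −β}`, `β = 3/100`, whence (weighted half-line Paley–Wiener, (R-c)) `r = c·eᵗ + r₁`,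
`∫₀^∞ |r₁| e^{βt} < ∞`. THIS FILE is the elementary step after that: with `|m₀(t)| ≤ C₀e^{−μt}`, `0 < β < μ`,
`m(t) = c·(∫₀^∞ e^{−s}m₀(s) ds)·eᵗ + m⊥(t)`, `|m⊥(t)| ≤ (C₀ + |c|C₀/(1 + μ) + C₀N)·e^{−βt}` (`norm_renewal_sub_growing_le`), where `N` bounds the
partial integrals `∫₀ᵀ |r₁| e^{βs} ds`. So `m` decays at rate `β` EXACTLY on the hyperplane `∫₀^∞ e^{−s}m₀(s) ds = 0` (the adjoint-gauge-orthogonal data).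
No definition, no named fact. WHAT THIS IS NOT: not NS; not the Paley–Wiener step; not a semigroup.
-/

noncomputable section

namespace Summit.NavierStokesRegularity.OSWSelfSimilar
namespace SheetRRenewalBookkeeping

open _root_.MeasureTheory _root_.Set _root_.Filter _root_.Real intervalIntegral
open scoped Topology

/-! ### §1 Two exponential integrals -/

/-- `∫_{(t,∞)} e^{−(1+μ)s} ds = e^{−(1+μ)t}/(1+μ)` for `1 + μ > 0`. [folklore] -/
theorem integral_Ioi_exp_neg (μ t : ℝ) (hμ : 0 < 1 + μ) :
    ∫ s in Ioi t, Real.exp (-(1 + μ) * s) = Real.exp (-(1 + μ) * t) / (1 + μ) := by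
  have h := integral_exp_mul_Ioi (a := -(1 + μ)) (by linarith) t
  rw [h]; field_simp

/-- The tail of `e^{−s}m₀(s)`: `‖∫_{(t,∞)} e^{−s} m₀(s) ds‖ ≤ C₀ e^{−(1+μ)t}/(1+μ)` when `‖m₀(s)‖ ≤ C₀e^{−μs}` on `s ≥ 0`, `t ≥ 0`, `μ > −1`. [folklore] -/
theorem norm_integral_Ioi_exp_mul_le {m₀ : ℝ → ℂ} (hm₀ : Continuous m₀) {C₀ μ : ℝ} (hμ : 0 < 1 + μ)
    (hb : ∀ s, 0 ≤ s → ‖m₀ s‖ ≤ C₀ * Real.exp (-μ * s)) {t : ℝ} (ht : 0 ≤ t) :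
    ‖∫ s in Ioi t, (Real.exp (-s) : ℂ) * m₀ s‖ ≤ C₀ * Real.exp (-(1 + μ) * t) / (1 + μ) := by
  have hdom : IntegrableOn (fun s => C₀ * Real.exp (-(1 + μ) * s)) (Ioi t) :=
    (integrableOn_exp_mul_Ioi (a := -(1 + μ)) (by linarith) t).const_mul C₀
  have hle : ∀ s ∈ Ioi t, ‖(Real.exp (-s) : ℂ) * m₀ s‖ ≤ C₀ * Real.exp (-(1 + μ) * s) := by
    intro s hs
    have hs0 : 0 ≤ s := le_trans ht (le_of_lt hs)
    rw [norm_mul, Complex.norm_real, Real.norm_eq_abs, abs_of_pos (Real.exp_pos _)]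
    calc Real.exp (-s) * ‖m₀ s‖ ≤ Real.exp (-s) * (C₀ * Real.exp (-μ * s)) :=
          mul_le_mul_of_nonneg_left (hb s hs0) (Real.exp_pos _).le
      _ = C₀ * Real.exp (-(1 + μ) * s) := by
          rw [show -(1 + μ) * s = -s + -μ * s by ring, Real.exp_add]; ring
  have hmeas : AEStronglyMeasurable (fun s => (Real.exp (-s) : ℂ) * m₀ s) (volume.restrict (Ioi t)) :=
    ((Complex.continuous_ofReal.comp (Real.continuous_exp.comp continuous_neg)).mul hm₀).aestronglyMeasurable
  have hint : IntegrableOn (fun s => (Real.exp (-s) : ℂ) * m₀ s) (Ioi t) :=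
    Integrable.mono' hdom hmeas ((ae_restrict_iff' measurableSet_Ioi).2 (Eventually.of_forall hle))
  calc ‖∫ s in Ioi t, (Real.exp (-s) : ℂ) * m₀ s‖ ≤ ∫ s in Ioi t, ‖(Real.exp (-s) : ℂ) * m₀ s‖ := norm_integral_le_integral_norm _
    _ ≤ ∫ s in Ioi t, C₀ * Real.exp (-(1 + μ) * s) := setIntegral_mono_on hint.norm hdom measurableSet_Ioi hle
    _ = C₀ * Real.exp (-(1 + μ) * t) / (1 + μ) := by
        rw [MeasureTheory.integral_const_mul, integral_Ioi_exp_neg μ t hμ]; ring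

/-! ### §2 The decay bookkeeping -/

/-- **DECAY OF THE GAUGE AMPLITUDE OFF THE GROWING MODE.** Let `m₀, r₁ : ℝ → ℂ` be continuous with `‖m₀(s)‖ ≤ C₀e^{−μs}` (`s ≥ 0`), let the weighted
partial integrals of `r₁` be bounded, `∫₀ᵀ ‖r₁(s)‖e^{βs} ds ≤ N` (`T ≥ 0`), with `0 < β < μ`, and let
`m(t) = m₀(t) + ∫₀ᵗ (c·e^{t−s} + r₁(t − s))·m₀(s) ds` (the renewal solution written through a resolvent split `r = c·eᵗ + r₁`). Then for `t ≥ 0`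
`‖m(t) − c·(∫₀^∞ e^{−s}m₀(s) ds)·eᵗ‖ ≤ (C₀ + ‖c‖·C₀/(1 + μ) + C₀·N)·e^{−βt}`. [folklore] -/
theorem norm_renewal_sub_growing_le {m₀ r₁ m : ℝ → ℂ} (hm₀ : Continuous m₀) (hr₁ : Continuous r₁) {C₀ N μ β : ℝ} {c : ℂ}
    (hβ : 0 < β) (hβμ : β < μ) (hb : ∀ s, 0 ≤ s → ‖m₀ s‖ ≤ C₀ * Real.exp (-μ * s))
    (hN : ∀ T, 0 ≤ T → ∫ s in (0 : ℝ)..T, ‖r₁ s‖ * Real.exp (β * s) ≤ N)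
    (hm : ∀ t, 0 ≤ t → m t = m₀ t + ∫ s in (0 : ℝ)..t, (c * (Real.exp (t - s) : ℂ) + r₁ (t - s)) * m₀ s) {t : ℝ} (ht : 0 ≤ t) :
    ‖m t - c * (∫ s in Ioi (0 : ℝ), (Real.exp (-s) : ℂ) * m₀ s) * (Real.exp t : ℂ)‖ ≤
      (C₀ + ‖c‖ * C₀ / (1 + μ) + C₀ * N) * Real.exp (-β * t) := by
  have hμ0 : 0 < μ := lt_trans hβ hβμ
  have hμ1 : 0 < 1 + μ := by linarith
  have hC₀ : 0 ≤ C₀ := by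
    have := hb 0 le_rfl
    rw [mul_zero, Real.exp_zero, mul_one] at this
    exact (norm_nonneg _).trans this
  -- continuity / integrability facts
  have hEm : Continuous fun s => (Real.exp (-s) : ℂ) * m₀ s :=
    (Complex.continuous_ofReal.comp (Real.continuous_exp.comp continuous_neg)).mul hm₀
  have hdom0 : IntegrableOn (fun s => C₀ * Real.exp (-(1 + μ) * s)) (Ioi 0) :=
    (integrableOn_exp_mul_Ioi (a := -(1 + μ)) (by linarith) 0).const_mul C₀
  have hle0 : ∀ s ∈ Ioi (0:ℝ), ‖(Real.exp (-s) : ℂ) * m₀ s‖ ≤ C₀ * Real.exp (-(1 + μ) * s) := by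
    intro s hs
    rw [norm_mul, Complex.norm_real, Real.norm_eq_abs, abs_of_pos (Real.exp_pos _)]
    calc Real.exp (-s) * ‖m₀ s‖ ≤ Real.exp (-s) * (C₀ * Real.exp (-μ * s)) :=
          mul_le_mul_of_nonneg_left (hb s (le_of_lt hs)) (Real.exp_pos _).le
      _ = C₀ * Real.exp (-(1 + μ) * s) := by
          rw [show -(1 + μ) * s = -s + -μ * s by ring, Real.exp_add]; ring
  have hint0 : IntegrableOn (fun s => (Real.exp (-s) : ℂ) * m₀ s) (Ioi 0) :=
    Integrable.mono' hdom0 hEm.aestronglyMeasurable.restrict ((ae_restrict_iff' measurableSet_Ioi).2 (Eventually.of_forall hle0))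
  -- split the improper integral at `t`
  have hsplit : ∫ s in Ioi (0 : ℝ), (Real.exp (-s) : ℂ) * m₀ s =
      (∫ s in (0 : ℝ)..t, (Real.exp (-s) : ℂ) * m₀ s) + ∫ s in Ioi t, (Real.exp (-s) : ℂ) * m₀ s := by
    rw [intervalIntegral.integral_of_le ht, ← setIntegral_union (Set.Ioc_disjoint_Ioi le_rfl) measurableSet_Ioi
      (hint0.mono_set Ioc_subset_Ioi_self) (hint0.mono_set (Ioi_subset_Ioi ht)), Ioc_union_Ioi_eq_Ioi ht]
  -- the growing part of the integral: `∫₀ᵗ c e^{t−s} m₀ = c eᵗ ∫₀ᵗ e^{−s} m₀`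
  have hI1 : IntervalIntegrable (fun s => (c * (Real.exp (t - s) : ℂ)) * m₀ s) volume 0 t :=
    ((continuous_const.mul (Complex.continuous_ofReal.comp (Real.continuous_exp.comp (continuous_const.sub continuous_id)))).mul
      hm₀).intervalIntegrable _ _
  have hI2 : IntervalIntegrable (fun s => r₁ (t - s) * m₀ s) volume 0 t :=
    ((hr₁.comp (continuous_const.sub continuous_id)).mul hm₀).intervalIntegrable _ _
  have hgrow : ∫ s in (0 : ℝ)..t, (c * (Real.exp (t - s) : ℂ)) * m₀ s =
      c * (Real.exp t : ℂ) * ∫ s in (0 : ℝ)..t, (Real.exp (-s) : ℂ) * m₀ s := by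
    rw [← intervalIntegral.integral_const_mul]
    refine intervalIntegral.integral_congr fun s _ => ?_
    show c * (Real.exp (t - s) : ℂ) * m₀ s = c * (Real.exp t : ℂ) * ((Real.exp (-s) : ℂ) * m₀ s)
    rw [show t - s = t + -s by ring, Real.exp_add, Complex.ofReal_mul]; ring
  -- rewrite `m t − (growing term)` as the sum of three decaying pieces
  have hdecomp : m t - c * (∫ s in Ioi (0 : ℝ), (Real.exp (-s) : ℂ) * m₀ s) * (Real.exp t : ℂ) =
      m₀ t - c * (Real.exp t : ℂ) * (∫ s in Ioi t, (Real.exp (-s) : ℂ) * m₀ s) + ∫ s in (0 : ℝ)..t, r₁ (t - s) * m₀ s := by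
    rw [hm t ht, hsplit]
    have e : ∫ s in (0 : ℝ)..t, (c * (Real.exp (t - s) : ℂ) + r₁ (t - s)) * m₀ s =
        (∫ s in (0 : ℝ)..t, (c * (Real.exp (t - s) : ℂ)) * m₀ s) + ∫ s in (0 : ℝ)..t, r₁ (t - s) * m₀ s := by
      rw [← intervalIntegral.integral_add hI1 hI2]
      exact intervalIntegral.integral_congr fun s _ => by ring
    rw [e, hgrow]; ring
  -- bound each piece
  have h1 : ‖m₀ t‖ ≤ C₀ * Real.exp (-β * t) :=
    (hb t ht).trans (mul_le_mul_of_nonneg_left (Real.exp_le_exp.2 (by nlinarith)) hC₀)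
  have h2 : ‖c * (Real.exp t : ℂ) * ∫ s in Ioi t, (Real.exp (-s) : ℂ) * m₀ s‖ ≤ ‖c‖ * C₀ / (1 + μ) * Real.exp (-β * t) := by
    rw [norm_mul, norm_mul, Complex.norm_real, Real.norm_eq_abs, abs_of_pos (Real.exp_pos _)]
    have htail := norm_integral_Ioi_exp_mul_le hm₀ hμ1 hb ht
    calc ‖c‖ * Real.exp t * ‖∫ s in Ioi t, (Real.exp (-s) : ℂ) * m₀ s‖
        ≤ ‖c‖ * Real.exp t * (C₀ * Real.exp (-(1 + μ) * t) / (1 + μ)) :=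
          mul_le_mul_of_nonneg_left htail (by positivity)
      _ = ‖c‖ * C₀ / (1 + μ) * Real.exp (-μ * t) := by
          rw [show ‖c‖ * Real.exp t * (C₀ * Real.exp (-(1 + μ) * t) / (1 + μ)) =
              ‖c‖ * C₀ / (1 + μ) * (Real.exp t * Real.exp (-(1 + μ) * t)) by ring, ← Real.exp_add,
            show t + -(1 + μ) * t = -μ * t by ring]
      _ ≤ ‖c‖ * C₀ / (1 + μ) * Real.exp (-β * t) :=
          mul_le_mul_of_nonneg_left (Real.exp_le_exp.2 (by nlinarith)) (by positivity)
  have h3 : ‖∫ s in (0 : ℝ)..t, r₁ (t - s) * m₀ s‖ ≤ C₀ * N * Real.exp (-β * t) := by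
    have hptw : ∀ s ∈ Set.Icc (0:ℝ) t, ‖r₁ (t - s) * m₀ s‖ ≤ C₀ * Real.exp (-β * t) * (‖r₁ (t - s)‖ * Real.exp (β * (t - s))) := by
      intro s hs
      rw [norm_mul]
      have hm₀s := hb s hs.1
      have hexp : Real.exp (-μ * s) ≤ Real.exp (-β * t) * Real.exp (β * (t - s)) := by
        rw [← Real.exp_add]; exact Real.exp_le_exp.2 (by nlinarith [hs.1, hs.2])
      calc ‖r₁ (t - s)‖ * ‖m₀ s‖ ≤ ‖r₁ (t - s)‖ * (C₀ * Real.exp (-μ * s)) := mul_le_mul_of_nonneg_left hm₀s (norm_nonneg _)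
        _ ≤ ‖r₁ (t - s)‖ * (C₀ * (Real.exp (-β * t) * Real.exp (β * (t - s)))) :=
            mul_le_mul_of_nonneg_left (mul_le_mul_of_nonneg_left hexp hC₀) (norm_nonneg _)
        _ = C₀ * Real.exp (-β * t) * (‖r₁ (t - s)‖ * Real.exp (β * (t - s))) := by ring
    have hcont : Continuous fun s => ‖r₁ (t - s)‖ * Real.exp (β * (t - s)) :=
      ((hr₁.comp (continuous_const.sub continuous_id)).norm).mul (Real.continuous_exp.comp (continuous_const.mul (continuous_const.sub continuous_id)))
    calc ‖∫ s in (0 : ℝ)..t, r₁ (t - s) * m₀ s‖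
        ≤ ∫ s in (0 : ℝ)..t, C₀ * Real.exp (-β * t) * (‖r₁ (t - s)‖ * Real.exp (β * (t - s))) := by
          refine intervalIntegral.norm_integral_le_of_norm_le ht ?_ ((hcont.const_mul _).intervalIntegrable _ _)
          exact Eventually.of_forall fun s hs => hptw s ⟨hs.1.le, hs.2⟩
      _ = C₀ * Real.exp (-β * t) * ∫ s in (0 : ℝ)..t, ‖r₁ s‖ * Real.exp (β * s) := by
          rw [intervalIntegral.integral_const_mul]
          congr 1
          have := intervalIntegral.integral_comp_sub_left (fun u => ‖r₁ u‖ * Real.exp (β * u)) (a := 0) (b := t) t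
          simp only [sub_self, sub_zero] at this
          rw [this]
      _ ≤ C₀ * Real.exp (-β * t) * N := mul_le_mul_of_nonneg_left (hN t ht) (by positivity)
      _ = C₀ * N * Real.exp (-β * t) := by ring
  rw [hdecomp]
  calc ‖m₀ t - c * (Real.exp t : ℂ) * (∫ s in Ioi t, (Real.exp (-s) : ℂ) * m₀ s) + ∫ s in (0 : ℝ)..t, r₁ (t - s) * m₀ s‖
      ≤ ‖m₀ t‖ + ‖c * (Real.exp t : ℂ) * ∫ s in Ioi t, (Real.exp (-s) : ℂ) * m₀ s‖ + ‖∫ s in (0 : ℝ)..t, r₁ (t - s) * m₀ s‖ := by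
        exact (norm_add_le _ _).trans (add_le_add (norm_sub_le _ _) le_rfl)
    _ ≤ C₀ * Real.exp (-β * t) + ‖c‖ * C₀ / (1 + μ) * Real.exp (-β * t) + C₀ * N * Real.exp (-β * t) := by linarith [h1, h2, h3]
    _ = (C₀ + ‖c‖ * C₀ / (1 + μ) + C₀ * N) * Real.exp (-β * t) := by ring

/-- **Linear stability off the growing mode, scalar form.** Under the same hypotheses, if the datum is orthogonal to the growing mode in the renewal
sense, `∫₀^∞ e^{−s} m₀(s) ds = 0`, then `‖m(t)‖ ≤ (C₀ + ‖c‖C₀/(1+μ) + C₀N)·e^{−βt}` for all `t ≥ 0`. [folklore] -/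
theorem norm_renewal_le_of_orthogonal {m₀ r₁ m : ℝ → ℂ} (hm₀ : Continuous m₀) (hr₁ : Continuous r₁) {C₀ N μ β : ℝ} {c : ℂ}
    (hβ : 0 < β) (hβμ : β < μ) (hb : ∀ s, 0 ≤ s → ‖m₀ s‖ ≤ C₀ * Real.exp (-μ * s))
    (hN : ∀ T, 0 ≤ T → ∫ s in (0 : ℝ)..T, ‖r₁ s‖ * Real.exp (β * s) ≤ N)
    (hm : ∀ t, 0 ≤ t → m t = m₀ t + ∫ s in (0 : ℝ)..t, (c * (Real.exp (t - s) : ℂ) + r₁ (t - s)) * m₀ s)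
    (horth : ∫ s in Ioi (0 : ℝ), (Real.exp (-s) : ℂ) * m₀ s = 0) {t : ℝ} (ht : 0 ≤ t) :
    ‖m t‖ ≤ (C₀ + ‖c‖ * C₀ / (1 + μ) + C₀ * N) * Real.exp (-β * t) := by
  have h := norm_renewal_sub_growing_le hm₀ hr₁ hβ hβμ hb hN hm ht
  rwa [horth, mul_zero, zero_mul, sub_zero] at h

end SheetRRenewalBookkeeping
end Summit.NavierStokesRegularity.OSWSelfSimilar

end
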